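import Literature.NumberTheory.EllipticCurves.RohrlichNonvanishingCoeffFieldProofs
import Literature.NumberTheory.LFunctions.KloostermanWeilReduction
import Literature.NumberTheory.LFunctions.KloostermanPrimePowerTools
import HarnessLib

/-!
# Rohrlich's non-vanishing theorem for a general finite set of primes `P` — the arithmetic of
# composite conductors (support, admissible exponents, Kloosterman sums)

Topic `NumberTheory/EllipticCurves`; continuation of `RohrlichNonvanishingProofs` (rational newforms,
`P = {p}`) and `RohrlichNonvanishingCoeffFieldProofs` (arbitrary newforms, `P = {p}`) towards the
named fact `Rohrlich1984_nonvanishing_twists` of `RohrlichNonvanishing` (Rohrlich 1984, Theorem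
p. 409: *every* finite set `P` of primes not dividing the level). The first-moment method of those
files is run, for a primitive character `ψ` of a *composite* `P`-smooth conductor `M`, over the
Galois family `ψ⟨ψ^r⟩ = {ψ^{1 + rj}}` with the step

  `r = r(P, n) = ∏_{q ∈ P} q^{v_q(n!) + 2} · ∏_{q ∈ P} (q - 1)`,  `n = [K_f : ℚ]`

(below only its two divisibility properties are used: `q^{v_q(n!)+2} ∣ r` for `q ∈ P` and
`∏_{q ∈ P} (q - 1) ∣ r`). This file supplies the arithmetic of composite moduli that replaces the
cyclic structure of `(ℤ/p^m)ˣ`; the analysis and the theorem itself are in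
`RohrlichNonvanishingCompositeProofs`. Everything is proved; no definition is introduced.

## Main statements

* `modEq_one_of_apply_eq_one` — **primitive characters are faithful on the principal congruence
  units**: if `ψ` is primitive mod `M`, `n ≡ 1 (mod ℓ)` for all primes `ℓ ∣ M`, `n ≡ 1 (mod 4)` if
  `4 ∣ M`, and `ψ(n) = 1`, then `n ≡ 1 (mod M)`. (No decomposition of `ψ` into local components is
  used: an offending prime `ℓ`, `v_ℓ(n - 1) < v_ℓ(M)`, is isolated by the Chinese remainder theorem
  on the *exponent* and lifting the exponent, producing a non-trivial element of the kernel `V_ℓ`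
  of `(ℤ/M)ˣ → (ℤ/(M/ℓ))ˣ` killed by `ψ`; `V_ℓ` has prime order, so `ψ` would factor through
  `M/ℓ` — `apply_ne_one_of_mem_ker_unitsMap_div`.)
* `card_filter_apply_eq_one_le`, `card_filter_apply_pow_eq_one_le` — hence
  `#ker ψ ≤ 4 rad(M)` and `#{z : ψ(z)^r = 1} ≤ 4 r rad(M)`, bounds independent of the exponents
  in `M` (the sparseness of the support of the family sum `∑_{χ ∈ ψ⟨ψ^r⟩} χ`).
* `pow_eq_one_of_apply_pow_eq_one` — the **support lemma**: for `r` even and divisible by `ℓ - 1`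
  (`ℓ ∣ M`), `ψ(z)^r = 1` forces `z^r = 1` in `ℤ/M`; with `rpow_inv_le_of_pow_natCast_eq_one`
  (`n^r ≡ 1 (mod M)`, `n ≥ 2 ⟹ n ≥ M^{1/r}`) the support contains no small integer `n ≥ 2`.
* `exists_coprime_pow_factorial_modEq_totient`, `aeval_pow_minpoly_eq_zero_of_modEq_one_step`
  — **the admissible exponents**: every `k ≡ 1 (mod r(P, n))` is an `n!`-th power in `(ℤ/φ(M))ˣ`
  for every `P`-smooth `M` (locally at `q ∈ P` by `exists_units_pow_eq_of_modEq_one_primePow`, the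
  `U_i`-filtration argument of `RohrlichNonvanishingCoeffFieldProofs`; at `q ∉ P` because the
  `q`-part of `φ(M)` divides `∏_{ℓ ∈ P} (ℓ - 1)`, by `φ(M) ∏_{ℓ ∣ M} ℓ = M ∏_{ℓ ∣ M} (ℓ - 1)`;
  glued by the Chinese remainder theorem), hence `ζ_{φ(M)}^k` is a `K`-conjugate of `ζ_{φ(M)}`
  for `[K : ℚ] = n` (`aeval_pow_factorial_minpoly_eq_zero`).
* `twistedSymbolSum_pow_eq_zero_of_modEq_one_step` — **the Galois step for a general modulus**
  (Rohrlich 1984, §1, with Shimura's theorem over `K_f`): `∑_a χ(a){∞, a/M}_f = 0` implies the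
  same for `χ^k`, `k ≡ 1 (mod r(P, [K_f:ℚ]))` odd.
* `isPrimitive_pow_of_coprime_orderOf` — `χ^k` is primitive for `χ` primitive, `(k, ord χ) = 1`.
* `norm_kloostermanSum_one_le_prod_primeFactors`, `norm_kloostermanSum_one_le_sqrt` — the
  elementary bound `|S(1, b; M)| ≤ ∏_{ℓ^m ∥ M} 4ℓ^{⌈m/2⌉} ≤ (∏_{ℓ ∈ P} 4ℓ) M^{1/2}` for `P`-smooth
  `M`, from the prime-power bound `norm_kloostermanSum_one_le` and twisted multiplicativity
  (`kloostermanSum_mul_of_coprime`).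

## References

* D. E. Rohrlich, *On `L`-functions of elliptic curves and cyclotomic towers*, Invent. Math. 75
  (1984), 409–423: Theorem (p. 409), §1, §3.
* G. Shimura, *On the periods of modular forms*, Math. Ann. 229 (1977), 211–221, Thm. 1.
* H. Iwaniec, E. Kowalski, *Analytic Number Theory*, AMS Colloq. Publ. 53 (2004), (1.59), §12.3.
* L. C. Washington, *Introduction to cyclotomic fields*, GTM 83, §7.2.
-/

noncomputable section

open scoped BigOperators Real IntermediateField
open Finset Polynomial

namespace Literature.NumberTheory.EllipticCurves

/-! ### Primitive characters modulo `M`: the kernel of reduction modulo `M/ℓ` -/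

section Faithful

variable {M : ℕ} [NeZero M]

/-- For a prime `ℓ` with `ℓ² ∣ M`, the kernel `V_ℓ` of `(ℤ/M)ˣ → (ℤ/(M/ℓ))ˣ` has `ℓ` elements
(`φ(M) = ℓ φ(M/ℓ)`). [folklore] -/
theorem card_ker_unitsMap_div {ℓ : ℕ} (hℓ : ℓ.Prime) (hℓM : ℓ ^ 2 ∣ M) :
    Nat.card (ZMod.unitsMap (Nat.div_dvd_of_dvd ((dvd_pow_self ℓ two_ne_zero).trans hℓM))).ker
      = ℓ := by
  have hℓd : ℓ ∣ M := (dvd_pow_self ℓ two_ne_zero).trans hℓM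
  have hdvd : M / ℓ ∣ M := Nat.div_dvd_of_dvd hℓd
  haveI : NeZero (M / ℓ) := ⟨(Nat.div_pos (Nat.le_of_dvd (NeZero.pos M) hℓd) hℓ.pos).ne'⟩
  set φ := ZMod.unitsMap hdvd with hφ
  have h1 : Nat.card φ.ker * φ.ker.index = Nat.card (ZMod M)ˣ := φ.ker.card_mul_index
  have h2 : φ.ker.index = Nat.card (ZMod (M / ℓ))ˣ := by
    rw [Subgroup.index_ker, MonoidHom.range_eq_top.mpr (ZMod.unitsMap_surjective _),
      Subgroup.card_top]
  have hℓd' : ℓ ∣ M / ℓ := by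
    rw [Nat.dvd_div_iff_mul_dvd hℓd, ← sq]; exact hℓM
  have htot : Nat.totient M = ℓ * Nat.totient (M / ℓ) := by
    conv_lhs => rw [← Nat.mul_div_cancel' hℓd]
    exact Nat.totient_mul_of_prime_of_dvd hℓ hℓd'
  rw [h2, Nat.card_eq_fintype_card (α := (ZMod (M / ℓ))ˣ),
    Nat.card_eq_fintype_card (α := (ZMod M)ˣ), ZMod.card_units_eq_totient,
    ZMod.card_units_eq_totient, htot] at h1
  exact Nat.eq_of_mul_eq_mul_right (Nat.totient_pos.mpr (NeZero.pos _)) h1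

/-- **A primitive character is non-trivial on every non-identity element of `V_ℓ`**, the kernel of
`(ℤ/M)ˣ → (ℤ/(M/ℓ))ˣ`, for a prime `ℓ` with `ℓ² ∣ M`: `V_ℓ` has prime order `ℓ`, so any
`x₀ ≠ 1` generates it, and a character trivial on `V_ℓ` factors through `M/ℓ`. [folklore] -/
theorem apply_ne_one_of_mem_ker_unitsMap_div {ψ : DirichletCharacter ℂ M} (hψ : ψ.IsPrimitive)
    {ℓ : ℕ} (hℓ : ℓ.Prime) (hℓM : ℓ ^ 2 ∣ M) {x₀ : (ZMod M)ˣ}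
    (hx₀ : x₀ ∈ (ZMod.unitsMap (Nat.div_dvd_of_dvd ((dvd_pow_self ℓ two_ne_zero).trans hℓM))).ker)
    (hx₀1 : x₀ ≠ 1) : ψ (x₀ : ZMod M) ≠ 1 := by
  have hℓd : ℓ ∣ M := (dvd_pow_self ℓ two_ne_zero).trans hℓM
  have hdvd : M / ℓ ∣ M := Nat.div_dvd_of_dvd hℓd
  haveI : Fact ℓ.Prime := ⟨hℓ⟩
  set V := (ZMod.unitsMap hdvd).ker with hV
  intro h1
  -- `x₀` generates `V`
  have hcard : Nat.card V = ℓ := card_ker_unitsMap_div hℓ hℓM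
  have hg1 : (⟨x₀, hx₀⟩ : V) ≠ 1 := fun h ↦ hx₀1 (by simpa using congr_arg Subtype.val h)
  have htop := zpowers_eq_top_of_prime_card hcard hg1
  -- so `ψ` is trivial on `V`
  have h1' : ψ.toUnitHom x₀ = 1 := by
    apply Units.ext
    rw [MulChar.coe_toUnitHom, Units.val_one]; exact h1
  have htriv : ∀ x ∈ V, ψ.toUnitHom x = 1 := by
    intro x hx
    have hmem : (⟨x, hx⟩ : V) ∈ Subgroup.zpowers (⟨x₀, hx₀⟩ : V) := by
      rw [htop]; exact Subgroup.mem_top _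
    obtain ⟨k, hk⟩ := Subgroup.mem_zpowers_iff.mp hmem
    have hk' : x₀ ^ k = x := by
      have := congr_arg Subtype.val hk
      simpa using this
    rw [← hk', map_zpow, h1', one_zpow]
  -- hence `ψ` factors through `M/ℓ < M`
  have hfac : ψ.FactorsThrough (M / ℓ) :=
    (DirichletCharacter.factorsThrough_iff_ker_unitsMap hdvd).mpr fun x hx ↦ htriv x hx
  have hcond : ψ.conductor ∣ M / ℓ := (ψ.mem_conductorSet_iff_conductor_dvd hdvd).mp hfac
  rw [hψ] at hcond
  have hlt : M / ℓ < M := Nat.div_lt_self (NeZero.pos M) hℓ.one_lt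
  have hpos : 0 < M / ℓ := Nat.div_pos (Nat.le_of_dvd (NeZero.pos M) hℓd) hℓ.pos
  exact absurd (Nat.le_of_dvd hpos hcond) (not_le.mpr hlt)

/-- **Primitive characters are faithful on the principal congruence units.** Let `ψ` be a
primitive Dirichlet character mod `M` and `n` a natural number with `n ≡ 1 (mod ℓ)` for every
prime `ℓ ∣ M`, `n ≡ 1 (mod 4)` if `4 ∣ M`, and `ψ(n) = 1`. Then `n ≡ 1 (mod M)`. Otherwise some
prime `ℓ ∣ M` has `j = v_ℓ(n - 1) < v_ℓ(M) = m`; raising `n` to a power `K ≡ 1 (mod ℓ^m)`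
divisible by `M/ℓ^m` and then to the power `ℓ^{m-1-j}` (lifting the exponent) produces
`w ≡ 1 (mod M/ℓ)`, `w ≢ 1 (mod M)` with `ψ(w) = 1`, contradicting
`apply_ne_one_of_mem_ker_unitsMap_div`. (For `M = p^m` this says that a primitive character is
non-trivial on `1 + p^{m-1}ℤ/p^mℤ`; the general case avoids the decomposition of `ψ` into local
components.) [folklore] -/
theorem modEq_one_of_apply_eq_one {ψ : DirichletCharacter ℂ M} (hψ : ψ.IsPrimitive) {n : ℕ}
    (h1 : ∀ ℓ ∈ M.primeFactors, n ≡ 1 [MOD ℓ]) (h4 : 4 ∣ M → n ≡ 1 [MOD 4]) (hn : ψ n = 1) :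
    n ≡ 1 [MOD M] := by
  have hM0 : M ≠ 0 := NeZero.ne M
  rcases eq_or_ne M 1 with hM1 | hM1
  · rw [hM1]; exact Nat.modEq_one
  have hn0 : n ≠ 0 := by
    rintro rfl
    rw [Nat.cast_zero, ψ.map_zero' hM1] at hn
    exact zero_ne_one hn
  have hn1 : 1 ≤ n := Nat.one_le_iff_ne_zero.mpr hn0
  by_contra hcon
  have hndvd : ¬ M ∣ n - 1 := fun h ↦ hcon ((Nat.modEq_iff_dvd' hn1).mpr h).symm
  rw [Nat.dvd_iff_prime_pow_dvd_dvd] at hndvd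
  push Not at hndvd
  obtain ⟨ℓ, k, hℓ, hℓkM, hℓkn⟩ := hndvd
  haveI : Fact ℓ.Prime := ⟨hℓ⟩
  set m : ℕ := M.factorization ℓ with hmdef
  have hkm : k ≤ m := (hℓ.pow_dvd_iff_le_factorization hM0).mp hℓkM
  have hk0 : k ≠ 0 := by rintro rfl; exact hℓkn (by simp)
  have hℓM : ℓ ∣ M := (dvd_pow_self ℓ hk0).trans hℓkM
  have hℓmem : ℓ ∈ M.primeFactors := Nat.mem_primeFactors.mpr ⟨hℓ, hℓM, hM0⟩
  have hn10 : n - 1 ≠ 0 := by intro h; rw [h] at hℓkn; exact hℓkn (dvd_zero _)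
  -- `j = v_ℓ(n - 1)`: `1 ≤ j < m`, and `2 ≤ j` if `ℓ = 2`
  set j : ℕ := padicValNat ℓ (n - 1) with hjdef
  have hjn : ℓ ^ j ∣ n - 1 := pow_padicValNat_dvd
  have hjn' : ¬ ℓ ^ (j + 1) ∣ n - 1 := pow_succ_padicValNat_not_dvd hn10
  have hjm : j < m := by
    by_contra h
    push Not at h
    exact hℓkn ((pow_dvd_pow ℓ (hkm.trans h)).trans hjn)
  have hj1 : 1 ≤ j := by
    have : ℓ ∣ n - 1 := (Nat.modEq_iff_dvd' hn1).mp (h1 ℓ hℓmem).symm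
    exact one_le_padicValNat_of_dvd hn10 this
  have hm2 : 2 ≤ m := by omega
  have hℓ2M : ℓ ^ 2 ∣ M := (hℓ.pow_dvd_iff_le_factorization hM0).mpr hm2
  have hj2 : ℓ = 2 → 2 ≤ j := by
    rintro rfl
    have h4' : 4 ∣ n - 1 := (Nat.modEq_iff_dvd' hn1).mp (h4 (by simpa using hℓ2M)).symm
    exact (padicValNat_dvd_iff_le hn10).mp (by simpa using h4')
  have hnj : n ≡ 1 [MOD ℓ ^ j] := ((Nat.modEq_iff_dvd' hn1).mpr hjn).symm
  -- `M = ℓ^m Q`, `Q` prime to `ℓ`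
  set Q : ℕ := M / ℓ ^ m with hQdef
  have hMQ : ℓ ^ m * Q = M := Nat.ordProj_mul_ordCompl_eq_self M ℓ
  have hℓQ : ℓ.Coprime Q := Nat.coprime_ordCompl hℓ hM0
  have hQ0 : Q ≠ 0 := by intro h; rw [h, mul_zero] at hMQ; exact hM0 hMQ.symm
  have hco : (ℓ ^ m).Coprime Q := Nat.Coprime.pow_left _ hℓQ
  -- the exponent `K ≡ 1 (mod ℓ^m)`, `K ≡ 0 (mod Q)`
  set K := Nat.chineseRemainder hco 1 0 with hKdef
  have hK1 : (K : ℕ) ≡ 1 [MOD ℓ ^ m] := K.2.1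
  have hK0 : (K : ℕ) ≡ 0 [MOD Q] := K.2.2
  have hℓm1 : 1 < ℓ ^ m := Nat.one_lt_pow (by omega) hℓ.one_lt
  have hK1' : 1 ≤ (K : ℕ) := by
    by_contra h
    push Not at h
    have hK : (K : ℕ) = 0 := by omega
    rw [hK, Nat.ModEq, Nat.zero_mod, Nat.mod_eq_of_lt hℓm1] at hK1
    exact zero_ne_one hK1
  obtain ⟨s, hs⟩ : ℓ ^ m ∣ (K : ℕ) - 1 := (Nat.modEq_iff_dvd' hK1').mp hK1.symm
  have hKs : (K : ℕ) = ℓ ^ m * s + 1 := by omega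
  have hQK : Q ∣ (K : ℕ) := (Nat.modEq_zero_iff_dvd).mp hK0
  -- `w₀ = n^K`: `w₀ ≡ n (mod ℓ^m)`, `w₀ ≡ 1 (mod Q)`, `ψ(w₀) = 1`
  set w₀ : ℕ := n ^ (K : ℕ) with hw₀
  have hw₀1 : 1 ≤ w₀ := Nat.one_le_pow _ _ hn1
  have hnℓ : n ≡ 1 [MOD ℓ ^ 1] := by rw [pow_one]; exact h1 ℓ hℓmem
  have hw₀n : w₀ ≡ n [MOD ℓ ^ m] := by
    have h := (pow_prime_pow_modEq_one (p := ℓ) one_ne_zero hnℓ m).of_dvd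
      (pow_dvd_pow ℓ (Nat.le_add_left m 1))
    have h' : (n ^ ℓ ^ m) ^ s * n ≡ 1 ^ s * n [MOD ℓ ^ m] := (h.pow s).mul_right n
    rw [one_pow, one_mul] at h'
    rw [hw₀, hKs, pow_succ, pow_mul]
    exact h'
  have hw₀Q : w₀ ≡ 1 [MOD Q] := by
    refine ((Nat.modEq_iff_dvd' hw₀1).mpr ?_).symm
    rw [Nat.dvd_iff_prime_pow_dvd_dvd]
    intro p a hp hpaQ
    rcases Nat.eq_zero_or_pos a with rfl | ha
    · simp
    haveI : Fact p.Prime := ⟨hp⟩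
    have hpQ : p ∣ Q := (dvd_pow_self p ha.ne').trans hpaQ
    have hpM : p ∈ M.primeFactors :=
      Nat.mem_primeFactors.mpr ⟨hp, hpQ.trans ⟨ℓ ^ m, by rw [mul_comm]; exact hMQ.symm⟩, hM0⟩
    set b := Q.factorization p with hb
    have hab : a ≤ b := (hp.pow_dvd_iff_le_factorization hQ0).mp hpaQ
    have hpbK : p ^ b ∣ (K : ℕ) := (Nat.ordProj_dvd Q p).trans hQK
    obtain ⟨u, hu⟩ := hpbK
    have hnp : n ≡ 1 [MOD p ^ 1] := by rw [pow_one]; exact h1 p hpM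
    have h := pow_prime_pow_modEq_one (p := p) one_ne_zero hnp b
    have h' : w₀ ≡ 1 [MOD p ^ (1 + b)] := by
      have := h.pow u
      rw [one_pow, ← pow_mul, ← hu] at this
      exact this
    have h'' := (Nat.modEq_iff_dvd' hw₀1).mp h'.symm
    exact (pow_dvd_pow p (by omega : a ≤ 1 + b)).trans h''
  have hψw₀ : ψ w₀ = 1 := by
    rw [hw₀, Nat.cast_pow, map_pow, hn, one_pow]
  -- `w = w₀^{ℓ^t}`, `t = m - 1 - j`
  set t : ℕ := m - 1 - j with htdef
  set w : ℕ := w₀ ^ ℓ ^ t with hwdef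
  have hw1 : 1 ≤ w := Nat.one_le_pow _ _ hw₀1
  have hw₀j : w₀ ≡ 1 [MOD ℓ ^ j] := (hw₀n.of_dvd (pow_dvd_pow ℓ hjm.le)).trans hnj
  have hwj : w ≡ 1 [MOD ℓ ^ (j + t)] := pow_prime_pow_modEq_one (p := ℓ) (by omega) hw₀j t
  have hwQ : w ≡ 1 [MOD Q] := by simpa [hwdef] using hw₀Q.pow (ℓ ^ t)
  have hwnot : ¬ w ≡ 1 [MOD ℓ ^ m] := by
    intro h
    have h' : w₀ ^ ℓ ^ t ≡ 1 [MOD ℓ ^ ((j + 1) + t)] := by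
      rwa [show j + 1 + t = m by omega]
    have hk1 : w₀ ≡ 1 [MOD ℓ] := hw₀j.of_dvd (dvd_pow_self ℓ (by omega))
    have hk4 : ℓ = 2 → w₀ ≡ 1 [MOD 4] := by
      intro hℓ2
      have hj2' := hj2 hℓ2
      subst hℓ2
      exact hw₀j.of_dvd ⟨2 ^ (j - 2), by
        rw [show (4 : ℕ) = 2 ^ 2 by norm_num, ← pow_add]; congr 1; omega⟩
    have h'' := modEq_one_of_pow_prime_pow_modEq_one (p := ℓ) hk1 hk4 h'
    have : n ≡ 1 [MOD ℓ ^ (j + 1)] :=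
      ((hw₀n.of_dvd (pow_dvd_pow ℓ (by omega : j + 1 ≤ m))).symm).trans h''
    exact hjn' ((Nat.modEq_iff_dvd' hn1).mp this.symm)
  -- `w ≡ 1 (mod M/ℓ)`, `w ≢ 1 (mod M)`
  have hMℓ : M / ℓ = ℓ ^ (m - 1) * Q := by
    apply Nat.div_eq_of_eq_mul_left hℓ.pos
    have hpow : ℓ ^ m = ℓ * ℓ ^ (m - 1) := by
      rw [← pow_succ', Nat.sub_add_cancel (by omega)]
    rw [← hMQ, hpow]
    ring
  have hco' : (ℓ ^ (m - 1)).Coprime Q := Nat.Coprime.pow_left _ hℓQ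
  have hwMℓ : w ≡ 1 [MOD M / ℓ] := by
    rw [hMℓ]
    refine (Nat.modEq_and_modEq_iff_modEq_mul hco').mp ⟨?_, hwQ⟩
    rwa [show m - 1 = j + t by omega]
  have hwM : ¬ w ≡ 1 [MOD M] := fun h ↦ hwnot (h.of_dvd (Dvd.intro Q hMQ))
  -- the unit `x` of `w` lies in `V_ℓ ∖ {1}` and `ψ(x) = 1`: contradiction
  have hψw : ψ w = 1 := by rw [hwdef, Nat.cast_pow, map_pow, hψw₀, one_pow]
  have hu : IsUnit (w : ZMod M) := by
    by_contra hu
    rw [MulChar.map_nonunit ψ hu] at hψw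
    exact zero_ne_one hψw
  have hℓd : ℓ ∣ M := (dvd_pow_self ℓ two_ne_zero).trans hℓ2M
  have hdvd : M / ℓ ∣ M := Nat.div_dvd_of_dvd hℓd
  haveI : NeZero (M / ℓ) := ⟨(Nat.div_pos (Nat.le_of_dvd (NeZero.pos M) hℓd) hℓ.pos).ne'⟩
  have hxV : hu.unit ∈ (ZMod.unitsMap hdvd).ker := by
    rw [MonoidHom.mem_ker, Units.ext_iff, ZMod.unitsMap_val, Units.val_one, IsUnit.unit_spec,
      ZMod.cast_natCast hdvd, show (1 : ZMod (M / ℓ)) = ((1 : ℕ) : ZMod (M / ℓ)) by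
        rw [Nat.cast_one], ZMod.natCast_eq_natCast_iff]
    exact hwMℓ
  have hx1 : hu.unit ≠ 1 := by
    intro h
    have h' : (w : ZMod M) = ((1 : ℕ) : ZMod M) := by
      rw [← IsUnit.unit_spec hu, h, Units.val_one, Nat.cast_one]
    exact hwM ((ZMod.natCast_eq_natCast_iff _ _ _).mp h')
  have := apply_ne_one_of_mem_ker_unitsMap_div hψ hℓ hℓ2M hxV hx1
  rw [IsUnit.unit_spec] at this
  exact this hψw

end Faithful

/-! ### Counting the kernel of a primitive character; the support lemma -/

section Counting

variable {M : ℕ} [NeZero M]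

omit [NeZero M] in
/-- For a unit `z` mod `M` with `ψ(z) = 1`, `ψ(z⁻¹) = 1`. [folklore] -/
theorem apply_inv_eq_one_of_apply_eq_one (ψ : DirichletCharacter ℂ M) {z : ZMod M}
    (hz : IsUnit z) (h : ψ z = 1) : ψ z⁻¹ = 1 := by
  have : ψ (z⁻¹ * z) = 1 := by rw [ZMod.inv_mul_of_unit z hz, map_one]
  rwa [map_mul, h, mul_one] at this

/-- **The kernel of a primitive character has at most `4 · rad(M)` elements**:
`z ↦ z mod 4 rad(M)` is injective on `{z : ψ(z) = 1}` by `modEq_one_of_apply_eq_one`.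
[folklore] -/
theorem card_filter_apply_eq_one_le {ψ : DirichletCharacter ℂ M} (hψ : ψ.IsPrimitive) :
    (Finset.univ.filter fun z : ZMod M ↦ ψ z = 1).card ≤ 4 * ∏ ℓ ∈ M.primeFactors, ℓ := by
  classical
  set R₀ : ℕ := 4 * ∏ ℓ ∈ M.primeFactors, ℓ with hR₀
  have hR₀pos : 0 < R₀ :=
    Nat.mul_pos (by norm_num) (Finset.prod_pos fun ℓ hℓ ↦ (Nat.prime_of_mem_primeFactors hℓ).pos)
  haveI : NeZero R₀ := ⟨hR₀pos.ne'⟩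
  set S₁ := Finset.univ.filter fun z : ZMod M ↦ ψ z = 1 with hS₁
  set φ : ZMod M → ZMod R₀ := fun z ↦ ((z.val : ℕ) : ZMod R₀) with hφ
  have hinj : Set.InjOn φ S₁ := by
    intro z₁ hz₁ z₂ hz₂ h
    simp only [hS₁, Finset.coe_filter, Finset.mem_univ, true_and, Set.mem_setOf_eq] at hz₁ hz₂
    have hmod : z₁.val ≡ z₂.val [MOD R₀] := (ZMod.natCast_eq_natCast_iff _ _ _).mp h
    have hu₂ : IsUnit z₂ := by
      by_contra hu; rw [MulChar.map_nonunit ψ hu] at hz₂; exact zero_ne_one hz₂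
    set w : ZMod M := z₁ * z₂⁻¹ with hw
    have hψw : ψ (w.val : ℕ) = 1 := by
      rw [ZMod.natCast_zmod_val, hw, map_mul, hz₁, apply_inv_eq_one_of_apply_eq_one ψ hu₂ hz₂,
        one_mul]
    -- `w ≡ 1` modulo every `d ∣ M` with `d ∣ R₀`
    have hred : ∀ d : ℕ, d ∣ M → d ∣ R₀ → w.val ≡ 1 [MOD d] := by
      intro d hdM hdR
      haveI : NeZero d := ⟨fun h ↦ by rw [h] at hdM; exact NeZero.ne M (zero_dvd_iff.mp hdM)⟩
      have h12 : (ZMod.castHom hdM (ZMod d)) z₁ = (ZMod.castHom hdM (ZMod d)) z₂ := by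
        rw [ZMod.castHom_apply, ZMod.castHom_apply, ZMod.cast_eq_val, ZMod.cast_eq_val,
          ZMod.natCast_eq_natCast_iff]
        exact hmod.of_dvd hdR
      have hwd : (ZMod.castHom hdM (ZMod d)) w = 1 := by
        rw [hw, map_mul, h12, ← map_mul, ZMod.mul_inv_of_unit z₂ hu₂, map_one]
      rw [ZMod.castHom_apply, ZMod.cast_eq_val] at hwd
      rw [← ZMod.natCast_eq_natCast_iff, Nat.cast_one]
      exact hwd
    have h1 : ∀ ℓ ∈ M.primeFactors, w.val ≡ 1 [MOD ℓ] := fun ℓ hℓ ↦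
      hred ℓ (Nat.dvd_of_mem_primeFactors hℓ)
        (dvd_mul_of_dvd_right (Finset.dvd_prod_of_mem _ hℓ) 4)
    have h4 : 4 ∣ M → w.val ≡ 1 [MOD 4] := fun h4M ↦ hred 4 h4M (dvd_mul_right 4 _)
    have hwM := modEq_one_of_apply_eq_one hψ h1 h4 hψw
    have hw1 : w = 1 := by
      rw [← ZMod.natCast_zmod_val w, show (1 : ZMod M) = ((1 : ℕ) : ZMod M) by rw [Nat.cast_one],
        ZMod.natCast_eq_natCast_iff]
      exact hwM
    calc z₁ = w * z₂ := by rw [hw, mul_assoc, ZMod.inv_mul_of_unit z₂ hu₂, mul_one]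
      _ = z₂ := by rw [hw1, one_mul]
  calc S₁.card ≤ (Finset.univ : Finset (ZMod R₀)).card :=
        Finset.card_le_card_of_injOn φ (fun _ _ ↦ Finset.mem_univ _) hinj
    _ = R₀ := by rw [Finset.card_univ, ZMod.card]

/-- **`#{z ∈ (ℤ/M)ˣ : ψ(z)^r = 1} ≤ r · 4 rad(M)`** for a primitive `ψ` and `r ≥ 1`: the fibres of
`ψ` over the `≤ r` roots of `X^r = 1` are translates of the kernel. [folklore] -/
theorem card_filter_apply_pow_eq_one_le {ψ : DirichletCharacter ℂ M} (hψ : ψ.IsPrimitive)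
    {r : ℕ} (hr : 0 < r) :
    (Finset.univ.filter fun z : ZMod M ↦ IsUnit z ∧ ψ z ^ r = 1).card ≤
      r * (4 * ∏ ℓ ∈ M.primeFactors, ℓ) := by
  classical
  set B : ℕ := 4 * ∏ ℓ ∈ M.primeFactors, ℓ with hB
  set W : Finset ℂ := (Polynomial.nthRoots r (1 : ℂ)).toFinset with hW
  have hWcard : W.card ≤ r :=
    (Multiset.toFinset_card_le _).trans (Polynomial.card_nthRoots r 1)
  set F : ℂ → Finset (ZMod M) := fun w ↦ Finset.univ.filter fun z : ZMod M ↦ IsUnit z ∧ ψ z = w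
    with hF
  have hsub : (Finset.univ.filter fun z : ZMod M ↦ IsUnit z ∧ ψ z ^ r = 1) ⊆ W.biUnion F := by
    intro z hz
    rw [Finset.mem_filter] at hz
    rw [Finset.mem_biUnion]
    refine ⟨ψ z, ?_, ?_⟩
    · rw [hW, Multiset.mem_toFinset, Polynomial.mem_nthRoots hr]; exact hz.2.2
    · rw [hF, Finset.mem_filter]; exact ⟨Finset.mem_univ _, hz.2.1, rfl⟩
  have hFcard : ∀ w ∈ W, (F w).card ≤ B := by
    intro w _
    rcases (F w).eq_empty_or_nonempty with h0 | ⟨z₀, hz₀⟩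
    · rw [h0, Finset.card_empty]; exact Nat.zero_le _
    rw [hF, Finset.mem_filter] at hz₀
    obtain ⟨-, hu₀, hψ₀⟩ := hz₀
    have hw0 : w ≠ 0 := by rw [← hψ₀]; exact (hu₀.map ψ).ne_zero
    have hψinv : ψ z₀⁻¹ = w⁻¹ := by
      have h : ψ (z₀⁻¹ * z₀) = 1 := by rw [ZMod.inv_mul_of_unit z₀ hu₀, map_one]
      rw [map_mul, hψ₀] at h
      exact eq_inv_of_mul_eq_one_left h
    set g : ZMod M → ZMod M := fun z ↦ z * z₀⁻¹ with hg
    have hmaps : ∀ z ∈ F w, g z ∈ Finset.univ.filter fun z : ZMod M ↦ ψ z = 1 := by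
      intro z hz
      rw [hF, Finset.mem_filter] at hz
      rw [Finset.mem_filter]
      refine ⟨Finset.mem_univ _, ?_⟩
      rw [hg]
      dsimp only
      rw [map_mul, hz.2.2, hψinv, mul_inv_cancel₀ hw0]
    have hinj : Set.InjOn g (F w) := by
      intro z₁ _ z₂ _ h
      simp only [hg] at h
      calc z₁ = z₁ * z₀⁻¹ * z₀ := by rw [mul_assoc, ZMod.inv_mul_of_unit z₀ hu₀, mul_one]
        _ = z₂ * z₀⁻¹ * z₀ := by rw [h]
        _ = z₂ := by rw [mul_assoc, ZMod.inv_mul_of_unit z₀ hu₀, mul_one]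
    exact (Finset.card_le_card_of_injOn g hmaps hinj).trans (card_filter_apply_eq_one_le hψ)
  calc _ ≤ (W.biUnion F).card := Finset.card_le_card hsub
    _ ≤ ∑ w ∈ W, (F w).card := Finset.card_biUnion_le
    _ ≤ ∑ _w ∈ W, B := Finset.sum_le_sum hFcard
    _ = W.card * B := by rw [Finset.sum_const, smul_eq_mul]
    _ ≤ r * B := Nat.mul_le_mul_right _ hWcard

/-- **The support lemma for a general modulus.** Let `ψ` be primitive mod `M`, `r` even and
divisible by `ℓ - 1` for every prime `ℓ ∣ M`, and `z` a unit mod `M` with `ψ(z)^r = 1`. Then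
`z^r = 1` in `ℤ/M`: the integer `n = z^r` has `ψ(n) = 1`, `n ≡ 1 (mod ℓ)` (Fermat) and
`n ≡ 1 (mod 8)`, so `modEq_one_of_apply_eq_one` applies. [folklore] -/
theorem pow_eq_one_of_apply_pow_eq_one {ψ : DirichletCharacter ℂ M} (hψ : ψ.IsPrimitive)
    {r : ℕ} (hr2 : 2 ∣ r) (hr : ∀ ℓ ∈ M.primeFactors, ℓ - 1 ∣ r) {z : ZMod M} (hz : IsUnit z)
    (hψz : ψ z ^ r = 1) : z ^ r = 1 := by
  set n : ℕ := z.val ^ r with hn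
  have hzn : (n : ZMod M) = z ^ r := by rw [hn, Nat.cast_pow, ZMod.natCast_zmod_val]
  have hcop : z.val.Coprime M := by
    obtain ⟨u, rfl⟩ := hz
    exact ZMod.val_coe_unit_coprime u
  have hψn : ψ n = 1 := by rw [hzn, map_pow, hψz]
  have h1 : ∀ ℓ ∈ M.primeFactors, n ≡ 1 [MOD ℓ] := by
    intro ℓ hℓ
    have hℓp := Nat.prime_of_mem_primeFactors hℓ
    have hc : z.val.Coprime ℓ := hcop.coprime_dvd_right (Nat.dvd_of_mem_primeFactors hℓ)
    have h := Nat.ModEq.pow_totient hc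
    rw [Nat.totient_prime hℓp] at h
    obtain ⟨c, hc'⟩ := hr ℓ hℓ
    rw [hn, hc', pow_mul]
    simpa using h.pow c
  have h4 : 4 ∣ M → n ≡ 1 [MOD 4] := by
    intro h4M
    have hc : z.val.Coprime 4 := hcop.coprime_dvd_right h4M
    have h := Nat.ModEq.pow_totient hc
    rw [show (4 : ℕ) = 2 ^ 2 by norm_num, Nat.totient_prime_pow Nat.prime_two two_pos] at h
    norm_num at h
    obtain ⟨c, hc'⟩ := hr2
    rw [hn, hc', pow_mul]
    simpa using h.pow c
  have hmod := modEq_one_of_apply_eq_one hψ h1 h4 hψn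
  rw [← hzn, show (1 : ZMod M) = ((1 : ℕ) : ZMod M) by rw [Nat.cast_one],
    ZMod.natCast_eq_natCast_iff]
  exact hmod

/-- **The sparse set of the main term, general exponent**: if `n ≥ 2` and `n^L ≡ 1 (mod q)` with
`L ≥ 1`, then `n ≥ q^{1/L}`. [folklore] -/
theorem rpow_inv_le_of_pow_natCast_eq_one {q L : ℕ} (hL : 0 < L) {n : ℕ} (hn : 2 ≤ n)
    (h : ((n : ℕ) : ZMod q) ^ L = 1) : (q : ℝ) ^ (1 / L : ℝ) ≤ n := by
  have hqn : q ≤ n ^ L := by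
    have hdvd : (q : ℤ) ∣ (n : ℤ) ^ L - 1 := by
      rw [← ZMod.intCast_zmod_eq_zero_iff_dvd]; push_cast; rw [h, sub_self]
    have hpos : (0 : ℤ) < (n : ℤ) ^ L - 1 := by
      have h2 : (2 : ℤ) ^ L ≤ (n : ℤ) ^ L := pow_le_pow_left₀ (by norm_num) (by exact_mod_cast hn) L
      have h1 : (2 : ℤ) ≤ 2 ^ L := by
        calc (2 : ℤ) = 2 ^ 1 := by norm_num
          _ ≤ 2 ^ L := pow_le_pow_right₀ (by norm_num) hL
      linarith
    have := Int.le_of_dvd hpos hdvd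
    have h' : (q : ℤ) ≤ (n : ℤ) ^ L := by linarith
    exact_mod_cast h'
  have hLr : (0 : ℝ) < L := Nat.cast_pos.mpr hL
  have hq' : (q : ℝ) ≤ (n : ℝ) ^ (L : ℝ) := by
    rw [Real.rpow_natCast]; exact_mod_cast hqn
  calc (q : ℝ) ^ (1 / L : ℝ) ≤ ((n : ℝ) ^ (L : ℝ)) ^ (1 / L : ℝ) :=
        Real.rpow_le_rpow (Nat.cast_nonneg _) hq' (by positivity)
    _ = n := by
        rw [← Real.rpow_mul (Nat.cast_nonneg _), mul_one_div_cancel hLr.ne', Real.rpow_one]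

end Counting

/-! ### `n!`-th roots modulo `φ(M)`: one prime at a time and the Chinese remainder theorem -/

section Roots

/-- **`E`-th roots of `k ≡ 1 (mod p^e)` modulo `p^a`** (`e ≥ v_p(E) + 2`): the local part of
`exists_units_pow_eq_of_modEq_one` — in `U_{e - v_p(E)}` extract a `p^{v_p(E)}`-th root
(`exists_mem_ker_pow_eq`) and then a prime-to-`p` root (`exists_pow_eq_of_coprime_of_modEq_one`).
[folklore] -/
theorem exists_units_pow_eq_of_modEq_one_primePow {p : ℕ} [hp : Fact p.Prime] {a e E : ℕ}
    (hE : E ≠ 0) (he : padicValNat p E + 2 ≤ e) {k : ℕ} (hk : k ≡ 1 [MOD p ^ e])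
    (hka : k.Coprime (p ^ a)) :
    ∃ t : (ZMod (p ^ a))ˣ, t ^ E = ZMod.unitOfCoprime k hka := by
  haveI : NeZero (p ^ a) := ⟨pow_ne_zero _ hp.out.ne_zero⟩
  set v : ℕ := padicValNat p E with hv
  obtain ⟨w, hEw⟩ : p ^ v ∣ E := pow_padicValNat_dvd
  have hwp : w.Coprime p := by
    rw [Nat.coprime_comm, hp.out.coprime_iff_not_dvd]
    rintro ⟨c, rfl⟩
    have : p ^ (v + 1) ∣ E := ⟨c, by rw [hEw]; ring⟩
    exact pow_succ_padicValNat_not_dvd hE this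
  rcases Nat.lt_or_ge e a with hea | hea
  · -- `e < a`: `k ∈ U_e = U_{(e-v)+v}`
    have hx : ZMod.unitOfCoprime k hka ∈ (ZMod.unitsMap (pow_dvd_pow p hea.le)).ker := by
      rw [mem_ker_unitsMap_iff hea.le, ZMod.coe_unitOfCoprime, ZMod.val_natCast]
      exact ((Nat.mod_modEq _ _).of_dvd (pow_dvd_pow p hea.le)).trans hk
    have hsplit : (e - v) + v = e := by omega
    have hjva : (e - v) + v ≤ a := by omega
    have hx' : ZMod.unitOfCoprime k hka ∈ (ZMod.unitsMap (pow_dvd_pow p hjva)).ker := by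
      convert hx using 3 <;> rw [hsplit]
    obtain ⟨u, hu, hux⟩ := exists_mem_ker_pow_eq (by omega : 2 ≤ e - v) hjva hx'
    have hu1 : (u : ZMod (p ^ a)).val ≡ 1 [MOD p] :=
      ((mem_ker_unitsMap_iff ((Nat.le_add_right _ _).trans hjva) u).mp hu).of_dvd
        (dvd_pow_self p (by omega))
    obtain ⟨t, -, htu⟩ := exists_pow_eq_of_coprime_of_modEq_one (by omega) hwp hu1
    refine ⟨t, ?_⟩
    rw [hEw, mul_comm, pow_mul, htu, hux]
  · -- `a ≤ e`: `k ≡ 1 (mod p^a)`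
    refine ⟨1, ?_⟩
    rw [one_pow]
    apply Units.ext
    rw [Units.val_one, ZMod.coe_unitOfCoprime,
      show (1 : ZMod (p ^ a)) = ((1 : ℕ) : ZMod (p ^ a)) by rw [Nat.cast_one],
      ZMod.natCast_eq_natCast_iff]
    exact (hk.of_dvd (pow_dvd_pow p hea)).symm

/-- `a ≡ b (mod D)` as soon as `a ≡ b (mod q^{v_q(D)})` for every prime `q ∣ D`. [folklore] -/
theorem modEq_of_forall_primeFactors_modEq {D a b : ℕ} (hD : D ≠ 0)
    (h : ∀ q ∈ D.primeFactors, a ≡ b [MOD q ^ D.factorization q]) : a ≡ b [MOD D] := by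
  rw [Nat.modEq_iff_dvd, Int.natCast_dvd, Nat.dvd_iff_prime_pow_dvd_dvd]
  intro p k hp hpk
  rcases Nat.eq_zero_or_pos k with rfl | hk
  · simp
  have hpD : p ∣ D := (dvd_pow_self p hk.ne').trans hpk
  have hmem : p ∈ D.primeFactors := Nat.mem_primeFactors.mpr ⟨hp, hpD, hD⟩
  have hkle : k ≤ D.factorization p := (hp.pow_dvd_iff_le_factorization hD).mp hpk
  have h' := h p hmem
  rw [Nat.modEq_iff_dvd, Int.natCast_dvd] at h'
  exact (pow_dvd_pow p hkle).trans h'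

/-- **Chinese remainder theorem for `E`-th roots**: if `k` is an `E`-th power of a prime-to-`q`
number modulo `q^{v_q(D)}` for every prime `q ∣ D`, then `k ≡ z^E (mod D)` with `z` prime to `D`.
[folklore] -/
theorem exists_coprime_pow_modEq_of_forall_primeFactors {D E k : ℕ} (hD : D ≠ 0)
    (h : ∀ q ∈ D.primeFactors, ∃ t : ℕ, ¬ q ∣ t ∧ t ^ E ≡ k [MOD q ^ D.factorization q]) :
    ∃ z : ℕ, z.Coprime D ∧ z ^ E ≡ k [MOD D] := by
  classical
  choose! t ht hte using h
  set s : ℕ → ℕ := fun q ↦ q ^ D.factorization q with hs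
  have hs0 : ∀ q ∈ D.primeFactors, s q ≠ 0 := fun q hq ↦
    pow_ne_zero _ (Nat.prime_of_mem_primeFactors hq).ne_zero
  have hpp : Set.Pairwise (↑D.primeFactors : Set ℕ) (Function.onFun Nat.Coprime s) := by
    intro q₁ hq₁ q₂ hq₂ hne
    exact Nat.coprime_pow_primes _ _ (Nat.prime_of_mem_primeFactors hq₁)
      (Nat.prime_of_mem_primeFactors hq₂) hne
  set z := Nat.chineseRemainderOfFinset t s D.primeFactors hs0 hpp with hz
  have hzq : ∀ q ∈ D.primeFactors, (z : ℕ) ≡ t q [MOD s q] := z.2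
  refine ⟨z, ?_, ?_⟩
  · refine Nat.coprime_of_dvd fun q hq hqz hqD ↦ ?_
    have hqmem : q ∈ D.primeFactors := Nat.mem_primeFactors.mpr ⟨hq, hqD, hD⟩
    have h1 : (z : ℕ) ≡ t q [MOD q] := by
      refine (hzq q hqmem).of_dvd (dvd_pow_self q ?_)
      exact (hq.factorization_pos_of_dvd hD hqD).ne'
    have h2 : t q ≡ 0 [MOD q] := h1.symm.trans (Nat.modEq_zero_iff_dvd.mpr hqz)
    exact ht q hqmem (Nat.modEq_zero_iff_dvd.mp h2)
  · refine modEq_of_forall_primeFactors_modEq hD fun q hq ↦ ?_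
    exact ((hzq q hq).pow E).trans (hte q hq)

/-- **`k ≡ 1 (mod r)` is an `n!`-th power modulo `φ(M)` for every `P`-smooth `M`**, whenever the
step `r` is divisible by `q^{v_q(n!)+2}` for `q ∈ P` and by `∏_{q ∈ P} (q - 1)` (e.g.
`r = r(P, n) = ∏_{q ∈ P} q^{v_q(n!) + 2} · ∏_{q ∈ P} (q - 1)`, the step of the Galois families of
`RohrlichNonvanishingCompositeProofs`). For a prime `q ∣ φ(M)`: if `q ∈ P` then
`k ≡ 1 (mod q^{v_q(n!)+2})` has an `n!`-th root modulo any power of `q`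
(`exists_units_pow_eq_of_modEq_one_primePow`); if `q ∉ P` then, as
`φ(M) ∏_{ℓ ∣ M} ℓ = M ∏_{ℓ ∣ M} (ℓ - 1)` and `q ∤ M`, the `q`-part of `φ(M)` divides
`∏_{ℓ ∈ P} (ℓ - 1) ∣ r`, so `k ≡ 1`; glue by the Chinese remainder theorem. [folklore] -/
theorem exists_coprime_pow_factorial_modEq_totient {P : Finset ℕ}
    {M : ℕ} (hM : M ≠ 0) (hMP : M.primeFactors ⊆ P) (n : ℕ) {r k : ℕ}
    (hrP : ∀ q ∈ P, q ^ (padicValNat q n.factorial + 2) ∣ r) (hr1 : ∏ q ∈ P, (q - 1) ∣ r)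
    (hk : k ≡ 1 [MOD r]) :
    ∃ z : ℕ, z.Coprime (Nat.totient M) ∧ z ^ n.factorial ≡ k [MOD Nat.totient M] := by
  set D : ℕ := Nat.totient M with hDdef
  have hD : D ≠ 0 := (Nat.totient_pos.mpr (Nat.pos_of_ne_zero hM)).ne'
  set E : ℕ := n.factorial with hEdef
  have hE : E ≠ 0 := Nat.factorial_ne_zero n
  have hDdvd : D ∣ M * ∏ ℓ ∈ M.primeFactors, (ℓ - 1) :=
    ⟨∏ ℓ ∈ M.primeFactors, ℓ, by rw [← Nat.totient_mul_prod_primeFactors]⟩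
  refine exists_coprime_pow_modEq_of_forall_primeFactors hD fun q hq ↦ ?_
  have hqp : q.Prime := Nat.prime_of_mem_primeFactors hq
  have hqD : q ∣ D := Nat.dvd_of_mem_primeFactors hq
  set a : ℕ := D.factorization q with hadef
  have hqaD : q ^ a ∣ D := Nat.ordProj_dvd D q
  by_cases hqP : q ∈ P
  · -- `q ∈ P`: extract an `E`-th root modulo `q^a`
    haveI : Fact q.Prime := ⟨hqp⟩
    set e : ℕ := padicValNat q E + 2 with hedef
    have hke : k ≡ 1 [MOD q ^ e] := hk.of_dvd (hrP q hqP)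
    have hkq : k.Coprime q := by
      have h1 : k ≡ 1 [MOD q] := hke.of_dvd (dvd_pow_self q (by omega))
      rw [Nat.Coprime, h1.gcd_eq, Nat.gcd_one_left]
    have hka : k.Coprime (q ^ a) := hkq.pow_right a
    obtain ⟨t, ht⟩ := exists_units_pow_eq_of_modEq_one_primePow (p := q) (a := a) hE le_rfl hke hka
    haveI : NeZero (q ^ a) := ⟨pow_ne_zero _ hqp.ne_zero⟩
    refine ⟨(t : ZMod (q ^ a)).val, ?_, ?_⟩
    · intro hqt
      have hcop : (t : ZMod (q ^ a)).val.Coprime (q ^ a) := ZMod.val_coe_unit_coprime t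
      have ha1 : 1 ≤ a := hqp.factorization_pos_of_dvd hD hqD
      have : q ∣ Nat.gcd (t : ZMod (q ^ a)).val (q ^ a) :=
        Nat.dvd_gcd hqt (dvd_pow_self q (by omega))
      rw [hcop] at this
      exact hqp.one_lt.ne' (Nat.dvd_one.mp this)
    · have h1 : ((((t : ZMod (q ^ a)).val ^ E : ℕ)) : ZMod (q ^ a)) = (k : ZMod (q ^ a)) := by
        rw [← units_pow_eq_natCast_pow, ht, ZMod.coe_unitOfCoprime]
      exact (ZMod.natCast_eq_natCast_iff _ _ _).mp h1
  · -- `q ∉ P`: `q^a ∣ r`, so `k ≡ 1 (mod q^a)`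
    have hqM : ¬ q ∣ M := fun h ↦ hqP (hMP (Nat.mem_primeFactors.mpr ⟨hqp, h, hM⟩))
    have hcop : (q ^ a).Coprime M := Nat.Coprime.pow_left a ((Nat.Prime.coprime_iff_not_dvd hqp).mpr hqM)
    have h1 : q ^ a ∣ ∏ ℓ ∈ M.primeFactors, (ℓ - 1) := hcop.dvd_of_dvd_mul_left (hqaD.trans hDdvd)
    have h2 : q ^ a ∣ r := (h1.trans (Finset.prod_dvd_prod_of_subset _ _ _ hMP)).trans hr1
    refine ⟨1, fun h ↦ hqp.one_lt.ne' (Nat.dvd_one.mp h), ?_⟩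
    rw [one_pow]
    exact (hk.of_dvd h2).symm

/-- `k ≡ 1 (mod r)` is prime to `φ(M)` for `P`-smooth `M` and a step `r` as above. [folklore] -/
theorem coprime_totient_of_modEq_one_step {P : Finset ℕ}
    {M : ℕ} (hM : M ≠ 0) (hMP : M.primeFactors ⊆ P) (n : ℕ) {r k : ℕ}
    (hrP : ∀ q ∈ P, q ^ (padicValNat q n.factorial + 2) ∣ r) (hr1 : ∏ q ∈ P, (q - 1) ∣ r)
    (hk : k ≡ 1 [MOD r]) : k.Coprime (Nat.totient M) := by
  obtain ⟨z, hz, hzk⟩ := exists_coprime_pow_factorial_modEq_totient hM hMP n hrP hr1 hk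
  have h : (z ^ n.factorial).Coprime (Nat.totient M) := hz.pow_left _
  rw [Nat.Coprime, ← hzk.gcd_eq] -- gcd k φ = gcd (z^E) φ
  exact h

variable (K : IntermediateField ℚ ℂ) [FiniteDimensional ℚ K]

/-- **`ζ^k` is a `K`-conjugate of `ζ = e^{2πi/φ(M)}` for every `k ≡ 1 (mod r)` and every
`P`-smooth `M`**, for a step `r` divisible by `q^{v_q([K:ℚ]!)+2}` (`q ∈ P`) and by
`∏_{q ∈ P} (q - 1)`: such `k` is a `[K:ℚ]!`-th power in `(ℤ/φ(M))ˣ`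
(`exists_coprime_pow_factorial_modEq_totient`), and all `[K:ℚ]!`-th powers are admissible
(`aeval_pow_factorial_minpoly_eq_zero`). The case `M = p^m`, `r = p^e (p - 1)` is
`aeval_pow_minpoly_eq_zero_of_modEq_one`. [folklore] -/
theorem aeval_pow_minpoly_eq_zero_of_modEq_one_step {P : Finset ℕ}
    {M : ℕ} (hM : M ≠ 0) (hMP : M.primeFactors ⊆ P) {r k : ℕ}
    (hrP : ∀ q ∈ P, q ^ (padicValNat q (Module.finrank ℚ K).factorial + 2) ∣ r)
    (hr1 : ∏ q ∈ P, (q - 1) ∣ r) (hk : k ≡ 1 [MOD r]) :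
    aeval (Complex.exp (2 * Real.pi * Complex.I / Nat.totient M) ^ k)
      (minpoly K (Complex.exp (2 * Real.pi * Complex.I / Nat.totient M))) = 0 := by
  set D : ℕ := Nat.totient M with hDdef
  haveI : NeZero D := ⟨(Nat.totient_pos.mpr (Nat.pos_of_ne_zero hM)).ne'⟩
  obtain ⟨z, hzD, hzk⟩ := exists_coprime_pow_factorial_modEq_totient hM hMP
    (Module.finrank ℚ K) hrP hr1 hk
  set g : (ZMod D)ˣ := ZMod.unitOfCoprime z hzD with hg
  have hadm := aeval_pow_factorial_minpoly_eq_zero K (D := D) g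
  have hmod : ((g ^ (Module.finrank ℚ K).factorial : (ZMod D)ˣ) : ZMod D).val ≡ k [MOD D] := by
    have h1 : ((g ^ (Module.finrank ℚ K).factorial : (ZMod D)ˣ) : ZMod D) =
        ((z ^ (Module.finrank ℚ K).factorial : ℕ) : ZMod D) := by
      rw [Units.val_pow_eq_pow_val, hg, ZMod.coe_unitOfCoprime, Nat.cast_pow]
    rw [h1, ZMod.val_natCast]
    exact (Nat.mod_modEq _ D).trans hzk
  rwa [aeval_pow_minpoly_eq_of_modEq K hmod] at hadm

end Roots

/-! ### Powers of primitive characters and the Galois step for a general modulus -/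

section GaloisGeneral

open ModularForms UpperHalfPlane

/-- **Primitivity along coprime powers** (any level): `χ^k` is primitive for `χ` primitive and
`k` coprime to the order of `χ` (`χ` is a power of `χ^k`, and `cond(ψ^j) ∣ cond(ψ)`). [folklore] -/
theorem isPrimitive_pow_of_coprime_orderOf {M : ℕ} [NeZero M] {χ : DirichletCharacter ℂ M}
    (hχ : χ.IsPrimitive) {k : ℕ} (hk : k.Coprime (orderOf χ)) : (χ ^ k).IsPrimitive := by
  obtain ⟨k', hk'⟩ := exists_pow_eq_self_of_coprime hk
  rw [DirichletCharacter.isPrimitive_def] at hχ ⊢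
  refine Nat.dvd_antisymm (DirichletCharacter.conductor_dvd_level _) ?_
  have h := DirichletCharacter.conductor_pow_dvd (χ ^ k) k'
  rw [hk', hχ] at h
  exact h

variable {N : ℕ} [NeZero N] {f : CuspForm (CongruenceSubgroup.Gamma0 N) 2}

/-- **Galois conjugation preserves the vanishing of `∑_a χ(a){∞, a/M}_f` for every newform and
every `P`-smooth modulus `M`** (Rohrlich 1984, §1, via Shimura 1977, Thm. 1): if
`∑_a χ(a){∞, a/M}_f = 0` for a character `χ` mod `M`, then `∑_a χ^k(a){∞, a/M}_f = 0` for every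
odd `k ≡ 1 (mod r)`, where the step `r` is divisible by `q^{v_q([K_f:ℚ]!)+2}` (`q ∈ P`) and by
`∏_{q ∈ P} (q - 1)`. As `twistedSymbolSum_pow_eq_zero_of_modEq_one` (the case `M = p^m`), with
`D = φ(M)` (`χ^D = 1`) and the admissible exponents of `aeval_pow_minpoly_eq_zero_of_modEq_one_step`;
`χ^k` has the parity of `χ` since `k` is odd. [cite: RohrlichInventiones1984, §1] -/
theorem twistedSymbolSum_pow_eq_zero_of_modEq_one_step (hf : IsNewform0 f) {P : Finset ℕ}
    {M : ℕ} [NeZero M] (hMP : M.primeFactors ⊆ P)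
    {χ : DirichletCharacter ℂ M} (h0 : twistedSymbolSum f χ = 0) {r k : ℕ} (hkodd : Odd k)
    (hrP : ∀ q ∈ P, q ^ (padicValNat q (Module.finrank ℚ (coeffField f)).factorial + 2) ∣ r)
    (hr1 : ∏ q ∈ P, (q - 1) ∣ r) (hk : k ≡ 1 [MOD r]) :
    twistedSymbolSum f (χ ^ k) = 0 := by
  set K : IntermediateField ℚ ℂ := coeffField f with hKdef
  haveI : FiniteDimensional ℚ K := IsNewform0.finiteDimensional_coeffField_holds hf
  have hM : M ≠ 0 := NeZero.ne M
  -- `χ ^ D = 1`, `D = φ(M)`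
  set D : ℕ := Nat.totient M with hD
  haveI : NeZero D := ⟨(Nat.totient_pos.mpr (NeZero.pos M)).ne'⟩
  have hχD : χ ^ D = 1 := by
    ext u
    rw [MulChar.pow_apply_coe, MulChar.one_apply_coe, ← map_pow, ← Units.val_pow_eq_pow_val,
      ZMod.pow_totient, Units.val_one, map_one]
  -- `ζ^k` is a `K`-conjugate of `ζ = e^{2πi/D}`
  have hadm := aeval_pow_minpoly_eq_zero_of_modEq_one_step K hM hMP hrP hr1 hk
  -- parity of `χ^k`
  have hpar : (χ ^ k) (-1) = χ (-1) := by
    rw [MulChar.pow_apply' χ hkodd.pos.ne']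
    rcases apply_neg_one_eq_one_or χ with h | h
    · rw [h, one_pow]
    · rw [h, hkodd.neg_one_pow]
  -- `K`-rationality of the symbols (Shimura)
  obtain ⟨Ωp, hΩp, hcp⟩ := hf.exists_plusSymbol_eq_mul
  obtain ⟨Ωm, hΩm, hcm⟩ := hf.exists_minusSymbol_eq_mul
  choose cp hcpK hcp using hcp
  choose cm hcmK hcm using hcm
  rcases apply_neg_one_eq_one_or χ with heven | hodd
  · -- even: plus symbols
    have hsum : ∀ ψ : DirichletCharacter ℂ M, ψ (-1) = 1 → twistedSymbolSum f ψ =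
        (Ωp : ℂ) * ∑ b : ZMod M, ψ b * cp ((b.val : ℚ) / M) := by
      intro ψ hψ
      rw [twistedSymbolSum_eq_sum_plusSymbol hψ, Finset.mul_sum]
      exact Finset.sum_congr rfl fun b _ ↦ by rw [hcp]; ring
    have hz : ∑ b : ZMod M, χ b * cp ((b.val : ℚ) / M) = 0 := by
      have h := hsum χ heven
      rw [h0] at h
      exact (mul_eq_zero.mp h.symm).resolve_left (Complex.ofReal_ne_zero.mpr hΩp)
    have hzk := sum_pow_apply_mul_eq_zero_of_aeval_minpoly K χ hχD
      (fun b ↦ cp ((b.val : ℚ) / M)) (fun b ↦ hcpK _) hz hadm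
    rw [hsum (χ ^ k) (by rw [hpar, heven]), hzk, mul_zero]
  · -- odd: minus symbols
    have hsum : ∀ ψ : DirichletCharacter ℂ M, ψ (-1) = -1 → twistedSymbolSum f ψ =
        ((Ωm : ℂ) * Complex.I) * ∑ b : ZMod M, ψ b * cm ((b.val : ℚ) / M) := by
      intro ψ hψ
      rw [twistedSymbolSum_eq_sum_minusSymbol hψ, Finset.mul_sum]
      exact Finset.sum_congr rfl fun b _ ↦ by rw [hcm]; ring
    have hz : ∑ b : ZMod M, χ b * cm ((b.val : ℚ) / M) = 0 := by
      have h := hsum χ hodd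
      rw [h0] at h
      refine (mul_eq_zero.mp h.symm).resolve_left ?_
      exact mul_ne_zero (Complex.ofReal_ne_zero.mpr hΩm) Complex.I_ne_zero
    have hzk := sum_pow_apply_mul_eq_zero_of_aeval_minpoly K χ hχD
      (fun b ↦ cm ((b.val : ℚ) / M)) (fun b ↦ hcmK _) hz hadm
    rw [hsum (χ ^ k) (by rw [hpar, hodd]), hzk, mul_zero]

end GaloisGeneral

/-! ### Kloosterman sums to a composite modulus -/

section KloostermanComposite

open LFunctions

/-- The inverse of a unit of `ℤ/qℤ` is a unit. [folklore] -/
theorem isUnit_inv_of_isUnit {q : ℕ} {x : ZMod q} (hx : IsUnit x) : IsUnit x⁻¹ :=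
  IsUnit.of_mul_eq_one x (ZMod.inv_mul_of_unit x hx)

/-- **The elementary square-root bound for Kloosterman sums to any modulus**:
`|S(1, b; M)| ≤ ∏_{ℓ^m ∥ M} 4 ℓ^{⌈m/2⌉}` for every `M ≥ 1` and every `b`, from the prime-power
bound `norm_kloostermanSum_one_le` by twisted multiplicativity
(`kloostermanSum_mul_of_coprime`, Iwaniec–Kowalski (1.59)) and induction over the coprime
factorisation. [folklore] -/
theorem norm_kloostermanSum_one_le_prod_primeFactors :
    ∀ (M : ℕ) [NeZero M] (b : ZMod M), ‖kloostermanSum M 1 b‖ ≤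
      ∏ ℓ ∈ M.primeFactors, 4 * (ℓ : ℝ) ^ (M.factorization ℓ - M.factorization ℓ / 2) := by
  intro M
  induction M using Nat.recOnPosPrimePosCoprime with
  | zero => intro h; exact (NeZero.ne 0 rfl).elim
  | one =>
    intro _ b
    rw [Nat.primeFactors_one, Finset.prod_empty]
    simpa using norm_kloostermanSum_le (q := 1) 1 b
  | prime_pow p n hp hn =>
    intro _ b
    haveI : Fact p.Prime := ⟨hp⟩
    rw [Nat.primeFactors_prime_pow hn.ne' hp, Finset.prod_singleton, hp.factorization_pow,
      Finsupp.single_eq_same]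
    exact norm_kloostermanSum_one_le n b
  | coprime a c ha hc hac iha ihc =>
    intro _ b
    haveI : NeZero a := ⟨by omega⟩
    haveI : NeZero c := ⟨by omega⟩
    have hua : IsUnit ((c : ZMod a)⁻¹) :=
      isUnit_inv_of_isUnit ((ZMod.isUnit_iff_coprime c a).mpr hac.symm)
    have huc : IsUnit ((a : ZMod c)⁻¹) :=
      isUnit_inv_of_isUnit ((ZMod.isUnit_iff_coprime a c).mpr hac)
    rw [kloostermanSum_mul_of_coprime hac 1 b, map_one, map_one, mul_one, mul_one,
      kloostermanSum_eq_one_mul hua, kloostermanSum_eq_one_mul huc, norm_mul,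
      hac.primeFactors_mul, Finset.prod_union hac.disjoint_primeFactors]
    have hfa : ∀ ℓ ∈ a.primeFactors, (a * c).factorization ℓ = a.factorization ℓ := by
      intro ℓ hℓ
      have hℓc : ¬ ℓ ∣ c := fun h ↦ Finset.disjoint_left.mp hac.disjoint_primeFactors hℓ
        (Nat.mem_primeFactors.mpr ⟨Nat.prime_of_mem_primeFactors hℓ, h, by omega⟩)
      rw [Nat.factorization_mul (by omega) (by omega), Finsupp.add_apply,
        Nat.factorization_eq_zero_of_not_dvd hℓc, add_zero]
    have hfc : ∀ ℓ ∈ c.primeFactors, (a * c).factorization ℓ = c.factorization ℓ := by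
      intro ℓ hℓ
      have hℓa : ¬ ℓ ∣ a := fun h ↦ Finset.disjoint_left.mp hac.disjoint_primeFactors
        (Nat.mem_primeFactors.mpr ⟨Nat.prime_of_mem_primeFactors hℓ, h, by omega⟩) hℓ
      rw [Nat.factorization_mul (by omega) (by omega), Finsupp.add_apply,
        Nat.factorization_eq_zero_of_not_dvd hℓa, zero_add]
    have ea : ∏ ℓ ∈ a.primeFactors, 4 * (ℓ : ℝ) ^ ((a * c).factorization ℓ - (a * c).factorization ℓ / 2)
        = ∏ ℓ ∈ a.primeFactors, 4 * (ℓ : ℝ) ^ (a.factorization ℓ - a.factorization ℓ / 2) :=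
      Finset.prod_congr rfl fun ℓ hℓ ↦ by rw [hfa ℓ hℓ]
    have ec : ∏ ℓ ∈ c.primeFactors, 4 * (ℓ : ℝ) ^ ((a * c).factorization ℓ - (a * c).factorization ℓ / 2)
        = ∏ ℓ ∈ c.primeFactors, 4 * (ℓ : ℝ) ^ (c.factorization ℓ - c.factorization ℓ / 2) :=
      Finset.prod_congr rfl fun ℓ hℓ ↦ by rw [hfc ℓ hℓ]
    rw [ea, ec]
    have h0 : ∀ (d : ℕ), 0 ≤ ∏ ℓ ∈ d.primeFactors,
        4 * (ℓ : ℝ) ^ (d.factorization ℓ - d.factorization ℓ / 2) :=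
      fun d ↦ Finset.prod_nonneg fun ℓ _ ↦ by positivity
    exact mul_le_mul (iha _) (ihc _) (norm_nonneg _) (h0 a)

/-- `∏_{ℓ^m ∥ M} 4 ℓ^{⌈m/2⌉} ≤ (∏_{ℓ ∈ P} 4ℓ) · M^{1/2}` for `P`-smooth `M`. [folklore] -/
theorem prod_primeFactors_kloostermanBound_le {P : Finset ℕ} (hP : ∀ q ∈ P, q.Prime) {M : ℕ}
    (hM : M ≠ 0) (hMP : M.primeFactors ⊆ P) :
    ∏ ℓ ∈ M.primeFactors, 4 * (ℓ : ℝ) ^ (M.factorization ℓ - M.factorization ℓ / 2) ≤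
      (∏ ℓ ∈ P, 4 * (ℓ : ℝ)) * (M : ℝ) ^ (1 / 2 : ℝ) := by
  have h1 : ∀ ℓ ∈ M.primeFactors, 4 * (ℓ : ℝ) ^ (M.factorization ℓ - M.factorization ℓ / 2) ≤
      (4 * (ℓ : ℝ)) * (((ℓ : ℝ) ^ M.factorization ℓ) ^ (1 / 2 : ℝ)) := by
    intro ℓ hℓ
    have hℓ1 : (1 : ℝ) ≤ ℓ := by exact_mod_cast (Nat.prime_of_mem_primeFactors hℓ).one_le
    have h := pow_ceil_half_le_offset hℓ1 (M.factorization ℓ)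
    calc 4 * (ℓ : ℝ) ^ (M.factorization ℓ - M.factorization ℓ / 2)
        ≤ 4 * ((ℓ : ℝ) * (((ℓ : ℝ) ^ M.factorization ℓ) ^ (1 / 2 : ℝ))) := by linarith
      _ = _ := by ring
  have hM' : ∏ ℓ ∈ M.primeFactors, ((ℓ : ℝ) ^ M.factorization ℓ) ^ (1 / 2 : ℝ) =
      (M : ℝ) ^ (1 / 2 : ℝ) := by
    rw [Real.finsetProd_rpow _ _ (fun ℓ _ ↦ by positivity)]
    congr 1
    have h := Nat.prod_factorization_pow_eq_self hM
    rw [Nat.prod_factorization_eq_prod_primeFactors] at h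
    exact_mod_cast h
  calc ∏ ℓ ∈ M.primeFactors, 4 * (ℓ : ℝ) ^ (M.factorization ℓ - M.factorization ℓ / 2)
      ≤ ∏ ℓ ∈ M.primeFactors, (4 * (ℓ : ℝ)) * (((ℓ : ℝ) ^ M.factorization ℓ) ^ (1 / 2 : ℝ)) :=
        Finset.prod_le_prod (fun ℓ _ ↦ by positivity) h1
    _ = (∏ ℓ ∈ M.primeFactors, 4 * (ℓ : ℝ)) * (M : ℝ) ^ (1 / 2 : ℝ) := by
        rw [Finset.prod_mul_distrib, hM']
    _ ≤ (∏ ℓ ∈ P, 4 * (ℓ : ℝ)) * (M : ℝ) ^ (1 / 2 : ℝ) := by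
        refine mul_le_mul_of_nonneg_right ?_ (by positivity)
        refine Finset.prod_le_prod_of_subset_of_one_le hMP (fun ℓ _ ↦ by positivity)
          fun ℓ hℓ _ ↦ ?_
        have : (1 : ℝ) ≤ ℓ := by exact_mod_cast (hP ℓ hℓ).one_le
        linarith

/-- **`|S(1, b; M)| ≤ (∏_{ℓ ∈ P} 4ℓ) M^{1/2}` for every `P`-smooth modulus `M`.** [folklore] -/
theorem norm_kloostermanSum_one_le_sqrt {P : Finset ℕ} (hP : ∀ q ∈ P, q.Prime) {M : ℕ} [NeZero M]
    (hMP : M.primeFactors ⊆ P) (b : ZMod M) :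
    ‖kloostermanSum M 1 b‖ ≤ (∏ ℓ ∈ P, 4 * (ℓ : ℝ)) * (M : ℝ) ^ (1 / 2 : ℝ) :=
  (norm_kloostermanSum_one_le_prod_primeFactors M b).trans
    (prod_primeFactors_kloostermanBound_le hP (NeZero.ne M) hMP)

end KloostermanComposite

end Literature.NumberTheory.EllipticCurves
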